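import Literature.NumberTheory.Sieve.CFSemigroupLaplace
import Literature.NumberTheory.Sieve.CFSemigroupRenewal
import Literature.NumberTheory.LFunctions.WienerIkeharaLaplace
import HarnessLib

/-!
# The renewal theorem for `Γ_A`: `N(X, x; G) ~ ν(G) c(x) X^{2δ_A}`

Support file (all results proved) for the named fact
`Literature.NumberTheory.Sieve.MageeOhWinter2019_uniformCounting` (`CFSemigroupCounting.lean`).
[MageeOhWinter2019, Prop. 17] (Lalley's renewal theorem [Lalley, Thm. 1] for the semigroup
`Γ_A`): for a non-negative Lipschitz test function `G` on `[0,1]`, the weighted dynamical counting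
function `N(X, x; G) = Σ_{w ∈ A^*, denom(M_w, x) ≤ X} G(M_w x)` satisfies
`N(X, x; G) ~ ν(G) c(x) X^{2δ_A}` as `X → ∞`, with `c(x) = h(x) / (δ_A κ) > 0`, `h` the
Ruelle–Perron–Frobenius eigenfunction, `ν` the eigenmeasure and `κ = ∫ 2 h log(1/·) dν` (the main
term of [MageeOhWinter2019, Thm. 11] for `q = 1`, without error term; `G ≡ 1` gives the plain
count `N(X, x) = #{w ∈ A^* : denom(M_w, x) ≤ X}`, and `x = 0` Hensley's count of continuants with
digits in `A`). The proof is the one of [MageeOhWinter2019, §3.1]: the Laplace transform of `N` is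
`s^{-1} Σ_n (L_{δs}ⁿ G)(x) = s^{-1} ((1 - L_{δs})^{-1} G)(x)` (`cfLaplace_eq`), which by
`CFSemigroupLaplace.lean` extends continuously to `Re s ≥ 1` apart from a simple pole at `s = 1`
with residue `ν(G) c(x)`; the Wiener–Ikehara Tauberian theorem in Laplace form
(`WienerIkehara.tendsto_of_laplace`, [MontgomeryVaughan2007, Thm. 8.6]) gives the asymptotic.

* `cfLenCountW`, `cfFullCountW` (and `cfLenCount`, `cfFullCount` for `G ≡ 1`): the weighted counts
  by word length and in full (`= Σ_{n ≤ N}` for any cut-off `N` with `2^N > X²`), monotone, `O(X^{2δ})`;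
* `integral_cfLenCountW`: `∫_0^∞ N_n(e^{u/2δ}, x; G) e^{-su} du = s^{-1} (L_{δs}ⁿ G)(x)`;
* `cfLaplace_eq`: `∫_0^∞ N(e^{u/2δ}, x; G) e^{-su} du = s^{-1} F_{G,x}(δ s)` for `Re s > 1`;
* `cfFullCountW_asymp`: **`N(X, x; G) X^{-2δ} → ν(G) c(x)`**; `cfFullCount_asymp`, `cfDynCount_asymp`:
  the case `G ≡ 1`. [cite: MageeOhWinter2019, Prop. 17]

## References

* M. Magee, H. Oh, D. Winter, J. reine angew. Math. 753 (2019) 89–135, §3.1, Prop. 17.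
  [MageeOhWinter2019]
* S. P. Lalley, Acta Math. 163 (1989) 1–55, Thm. 1.
* H. L. Montgomery, R. C. Vaughan, Multiplicative Number Theory I, CUP 2007, Thm. 8.6.
  [MontgomeryVaughan2007]
-/

noncomputable section

open Set Filter Metric MeasureTheory
open scoped Topology

namespace Literature.NumberTheory.Sieve

variable {A : Finset ℕ}

/-! ### The counts by word length -/

variable (A) in
/-- `N_n(X, x) = #{w ∈ Aⁿ : denom(M_w, x) ≤ X}`. [cite: MageeOhWinter2019, §3] -/
def cfLenCount (n : ℕ) (X x : ℝ) : ℝ :=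
  ∑ w : Fin n → A, if cfDenom (cfMat fun i => (w i : ℕ)) x ≤ X then (1 : ℝ) else 0

variable (A) in
/-- The weighted count `N_n(X, x; G) = Σ_{w ∈ Aⁿ, denom(M_w, x) ≤ X} G(M_w x)` for a test function
`G ∈ CfLip` (its real part is used). [cite: MageeOhWinter2019, §3 eq. (3.1)] -/
def cfLenCountW (G : CfLip) (n : ℕ) (X x : ℝ) : ℝ :=
  ∑ w : Fin n → A, (G.extend (cfMoeb (cfMat fun i => (w i : ℕ)) x)).re *
    (if cfDenom (cfMat fun i => (w i : ℕ)) x ≤ X then (1 : ℝ) else 0)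

/-- `N_N(X, x) = Σ_{n ≤ N} N_n(X, x)`. [folklore] -/
theorem cfDynCount_eq_sum (N : ℕ) (X x : ℝ) :
    cfDynCount A N X x = ∑ n ∈ Finset.range (N + 1), cfLenCount A n X x := rfl

/-- `N_n(X, x; 𝟙) = N_n(X, x)`. [folklore] -/
theorem cfLenCountW_const_one (n : ℕ) (X x : ℝ) : cfLenCountW A (CfLip.const 1) n X x = cfLenCount A n X x := by
  refine Finset.sum_congr rfl fun w _ => ?_
  rw [show (CfLip.const 1).extend (cfMoeb (cfMat fun i => (w i : ℕ)) x) = 1 from rfl, Complex.one_re, one_mul]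

/-- `N_n ≥ 0`. [folklore] -/
theorem cfLenCount_nonneg (n : ℕ) (X x : ℝ) : 0 ≤ cfLenCount A n X x :=
  Finset.sum_nonneg fun _ _ => by split_ifs <;> norm_num

/-- `N_n(·; G) ≥ 0` for `G ≥ 0`. [folklore] -/
theorem cfLenCountW_nonneg {G : CfLip} (hG0 : ∀ y : Icc (0 : ℝ) 1, 0 ≤ (G y).re) (n : ℕ) (X x : ℝ) :
    0 ≤ cfLenCountW A G n X x :=
  Finset.sum_nonneg fun _ _ => mul_nonneg (hG0 _) (by split_ifs <;> norm_num)

/-- `|N_n(X, x; G)| ≤ ‖G‖ N_n(X, x)`. [folklore] -/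
theorem cfLenCountW_le (G : CfLip) (n : ℕ) (X x : ℝ) : cfLenCountW A G n X x ≤ ‖G‖ * cfLenCount A n X x := by
  rw [cfLenCount, Finset.mul_sum]
  refine Finset.sum_le_sum fun w _ => mul_le_mul_of_nonneg_right ?_ (by split_ifs <;> norm_num)
  exact ((Complex.abs_re_le_norm _).trans (G.norm_extend_le _)).trans' (le_abs_self _)

/-- `N_n` is non-decreasing in `X`. [folklore] -/
theorem cfLenCount_mono (n : ℕ) (x : ℝ) : Monotone fun X => cfLenCount A n X x := by
  intro X X' hXX'
  refine Finset.sum_le_sum fun w _ => ?_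
  by_cases h : cfDenom (cfMat fun i => (w i : ℕ)) x ≤ X
  · rw [if_pos h, if_pos (h.trans hXX')]
  · rw [if_neg h]; split_ifs <;> norm_num

/-- `N_n(·; G)` is non-decreasing in `X` for `G ≥ 0`. [folklore] -/
theorem cfLenCountW_mono {G : CfLip} (hG0 : ∀ y : Icc (0 : ℝ) 1, 0 ≤ (G y).re) (n : ℕ) (x : ℝ) :
    Monotone fun X => cfLenCountW A G n X x := by
  intro X X' hXX'
  refine Finset.sum_le_sum fun w _ => mul_le_mul_of_nonneg_left ?_ (hG0 _)
  by_cases h : cfDenom (cfMat fun i => (w i : ℕ)) x ≤ X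
  · rw [if_pos h, if_pos (h.trans hXX')]
  · rw [if_neg h]; split_ifs <;> norm_num

/-- Long words do not contribute: `denom(M_w, x) > X` if `2^N > X²` and `|w| > N`. [folklore] -/
theorem lt_cfDenom_of_long (hA : ∀ a ∈ A, 1 ≤ a) {x : ℝ} (hx : x ∈ Icc (0 : ℝ) 1) {N : ℕ} {X : ℝ}
    (hX : X ^ 2 < (2 : ℝ) ^ N) {n : ℕ} (hn : N < n) (w : Fin n → A) : X < cfDenom (cfMat fun i => (w i : ℕ)) x := by
  have hw : ∀ i, 1 ≤ (fun i => (w i : ℕ)) i := one_le_coe_digit hA w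
  have hden := (cfDenom_cfMat_mem hw hx).1
  have hgrow : ((2 : ℤ) ^ (n - 1) : ℝ) ≤ (((cfQ fun i => (w i : ℕ)) : ℤ) : ℝ) ^ 2 := by
    exact_mod_cast pow_le_cfQ_sq hw
  push_cast at hgrow
  have hpow : (2 : ℝ) ^ N ≤ (2 : ℝ) ^ (n - 1) := pow_le_pow_right₀ (by norm_num) (by omega)
  have hq0 : (0 : ℝ) ≤ ((cfQ fun i => (w i : ℕ)) : ℝ) := by
    exact_mod_cast (zero_le_one.trans (one_le_cfQ hw))
  have hX0 : X < ((cfQ fun i => (w i : ℕ)) : ℝ) := by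
    by_contra h
    push Not at h
    have hXnn : 0 ≤ X := hq0.trans h
    nlinarith [pow_le_pow_left₀ hq0 h 2]
  linarith

/-- `N_n(X, x) = 0` if `2^N > X²` and `n > N`. [folklore] -/
theorem cfLenCount_eq_zero (hA : ∀ a ∈ A, 1 ≤ a) {x : ℝ} (hx : x ∈ Icc (0 : ℝ) 1) {N : ℕ} {X : ℝ}
    (hX : X ^ 2 < (2 : ℝ) ^ N) {n : ℕ} (hn : N < n) : cfLenCount A n X x = 0 :=
  Finset.sum_eq_zero fun w _ => if_neg (not_le.2 (lt_cfDenom_of_long hA hx hX hn w))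

/-- `N_n(X, x; G) = 0` if `2^N > X²` and `n > N`. [folklore] -/
theorem cfLenCountW_eq_zero (hA : ∀ a ∈ A, 1 ≤ a) (G : CfLip) {x : ℝ} (hx : x ∈ Icc (0 : ℝ) 1) {N : ℕ} {X : ℝ}
    (hX : X ^ 2 < (2 : ℝ) ^ N) {n : ℕ} (hn : N < n) : cfLenCountW A G n X x = 0 :=
  Finset.sum_eq_zero fun w _ => by rw [if_neg (not_le.2 (lt_cfDenom_of_long hA hx hX hn w)), mul_zero]

/-! ### The full counts -/

variable (A) in
/-- **The full dynamical count** `N(X, x) = #{w ∈ A^* : denom(M_w, x) ≤ X} = Σ_n N_n(X, x)`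
(Lalley's renewal counting function for `Γ_A`, `G ≡ 1`). [cite: MageeOhWinter2019, §3] -/
def cfFullCount (X x : ℝ) : ℝ := ∑' n, cfLenCount A n X x

variable (A) in
/-- **The weighted full count** `N(X, x; G) = Σ_{w ∈ A^*, denom(M_w, x) ≤ X} G(M_w x)`.
[cite: MageeOhWinter2019, §3 eq. (3.1)] -/
def cfFullCountW (G : CfLip) (X x : ℝ) : ℝ := ∑' n, cfLenCountW A G n X x

/-- `N(X, x; 𝟙) = N(X, x)`. [folklore] -/
theorem cfFullCountW_const_one (X x : ℝ) : cfFullCountW A (CfLip.const 1) X x = cfFullCount A X x :=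
  tsum_congr fun n => cfLenCountW_const_one n X x

/-- A cut-off with `2^N > X²` exists. [folklore] -/
theorem exists_pow_two_gt (X : ℝ) : ∃ N : ℕ, X ^ 2 < (2 : ℝ) ^ N :=
  pow_unbounded_of_one_lt _ (by norm_num)

/-- The length series has finite support. [folklore] -/
theorem summable_cfLenCount (hA : ∀ a ∈ A, 1 ≤ a) {x : ℝ} (hx : x ∈ Icc (0 : ℝ) 1) (X : ℝ) :
    Summable fun n => cfLenCount A n X x := by
  obtain ⟨N, hN⟩ := exists_pow_two_gt X
  refine summable_of_ne_finset_zero (s := Finset.range (N + 1)) fun n hn => ?_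
  rw [Finset.mem_range, not_lt] at hn
  exact cfLenCount_eq_zero hA hx hN (by omega)

/-- The weighted length series has finite support. [folklore] -/
theorem summable_cfLenCountW (hA : ∀ a ∈ A, 1 ≤ a) (G : CfLip) {x : ℝ} (hx : x ∈ Icc (0 : ℝ) 1) (X : ℝ) :
    Summable fun n => cfLenCountW A G n X x := by
  obtain ⟨N, hN⟩ := exists_pow_two_gt X
  refine summable_of_ne_finset_zero (s := Finset.range (N + 1)) fun n hn => ?_
  rw [Finset.mem_range, not_lt] at hn
  exact cfLenCountW_eq_zero hA G hx hN (by omega)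

/-- **`N(X, x) = N_N(X, x)` for any cut-off with `2^N > X²`.** [folklore] -/
theorem cfFullCount_eq_cfDynCount (hA : ∀ a ∈ A, 1 ≤ a) {x : ℝ} (hx : x ∈ Icc (0 : ℝ) 1) {N : ℕ} {X : ℝ}
    (hX : X ^ 2 < (2 : ℝ) ^ N) : cfFullCount A X x = cfDynCount A N X x := by
  rw [cfFullCount, cfDynCount_eq_sum, tsum_eq_sum]
  intro n hn
  rw [Finset.mem_range, not_lt] at hn
  exact cfLenCount_eq_zero hA hx hX (by omega)

/-- `N(X, x; G) = Σ_{n ≤ N} N_n(X, x; G)` for any cut-off with `2^N > X²`. [folklore] -/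
theorem cfFullCountW_eq_sum (hA : ∀ a ∈ A, 1 ≤ a) (G : CfLip) {x : ℝ} (hx : x ∈ Icc (0 : ℝ) 1) {N : ℕ} {X : ℝ}
    (hX : X ^ 2 < (2 : ℝ) ^ N) : cfFullCountW A G X x = ∑ n ∈ Finset.range (N + 1), cfLenCountW A G n X x := by
  rw [cfFullCountW, tsum_eq_sum]
  intro n hn
  rw [Finset.mem_range, not_lt] at hn
  exact cfLenCountW_eq_zero hA G hx hX (by omega)

/-- `N(X, x) ≥ 0`. [folklore] -/
theorem cfFullCount_nonneg (X x : ℝ) : 0 ≤ cfFullCount A X x :=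
  tsum_nonneg fun n => cfLenCount_nonneg n X x

/-- `N(X, x; G) ≥ 0` for `G ≥ 0`. [folklore] -/
theorem cfFullCountW_nonneg {G : CfLip} (hG0 : ∀ y : Icc (0 : ℝ) 1, 0 ≤ (G y).re) (X x : ℝ) :
    0 ≤ cfFullCountW A G X x :=
  tsum_nonneg fun n => cfLenCountW_nonneg hG0 n X x

/-- `N_N` is non-decreasing in `X`. [folklore] -/
theorem cfDynCount_mono (N : ℕ) (x : ℝ) : Monotone fun X => cfDynCount A N X x := fun _ _ h =>
  Finset.sum_le_sum fun n _ => cfLenCount_mono n x h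

/-- **`N(X, x)` is non-decreasing in `X`.** [folklore] -/
theorem cfFullCount_mono (hA : ∀ a ∈ A, 1 ≤ a) {x : ℝ} (hx : x ∈ Icc (0 : ℝ) 1) :
    Monotone fun X => cfFullCount A X x := by
  intro X X' h
  obtain ⟨N, hN⟩ := exists_pow_two_gt X
  obtain ⟨N', hN'⟩ := exists_pow_two_gt X'
  have h1 : X ^ 2 < (2 : ℝ) ^ max N N' := hN.trans_le (pow_le_pow_right₀ (by norm_num) (le_max_left _ _))
  have h2 : X' ^ 2 < (2 : ℝ) ^ max N N' := hN'.trans_le (pow_le_pow_right₀ (by norm_num) (le_max_right _ _))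
  show cfFullCount A X x ≤ cfFullCount A X' x
  rw [cfFullCount_eq_cfDynCount hA hx h1, cfFullCount_eq_cfDynCount hA hx h2]
  exact cfDynCount_mono _ x h

/-- **`N(X, x; G)` is non-decreasing in `X`** for `G ≥ 0`. [folklore] -/
theorem cfFullCountW_mono (hA : ∀ a ∈ A, 1 ≤ a) {G : CfLip} (hG0 : ∀ y : Icc (0 : ℝ) 1, 0 ≤ (G y).re) {x : ℝ}
    (hx : x ∈ Icc (0 : ℝ) 1) : Monotone fun X => cfFullCountW A G X x := by
  intro X X' h
  obtain ⟨N, hN⟩ := exists_pow_two_gt X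
  obtain ⟨N', hN'⟩ := exists_pow_two_gt X'
  have h1 : X ^ 2 < (2 : ℝ) ^ max N N' := hN.trans_le (pow_le_pow_right₀ (by norm_num) (le_max_left _ _))
  have h2 : X' ^ 2 < (2 : ℝ) ^ max N N' := hN'.trans_le (pow_le_pow_right₀ (by norm_num) (le_max_right _ _))
  show cfFullCountW A G X x ≤ cfFullCountW A G X' x
  rw [cfFullCountW_eq_sum hA G hx h1, cfFullCountW_eq_sum hA G hx h2]
  exact Finset.sum_le_sum fun n _ => cfLenCountW_mono hG0 n x h

/-- `N(X, x; G) ≤ ‖G‖ N(X, x)`. [folklore] -/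
theorem cfFullCountW_le_norm_mul (hA : ∀ a ∈ A, 1 ≤ a) (G : CfLip) {x : ℝ} (hx : x ∈ Icc (0 : ℝ) 1) (X : ℝ) :
    cfFullCountW A G X x ≤ ‖G‖ * cfFullCount A X x := by
  obtain ⟨N, hN⟩ := exists_pow_two_gt X
  rw [cfFullCountW_eq_sum hA G hx hN, cfFullCount_eq_cfDynCount hA hx hN, cfDynCount_eq_sum, Finset.mul_sum]
  exact Finset.sum_le_sum fun n _ => cfLenCountW_le G n X x

/-- **`N(X, x) = O(X^{2δ})`:** `N(X, x) ≤ K (1 + X^{2δ})` for `X ≥ 0`, `x ∈ [0,1]`.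
[cite: MageeOhWinter2019, Thm. 11] -/
theorem cfFullCount_le (hA : ∀ a ∈ A, 1 ≤ a) (h2 : 2 ≤ A.card) :
    ∃ K : ℝ, 0 < K ∧ ∀ x ∈ Icc (0 : ℝ) 1, ∀ X : ℝ, 0 ≤ X →
      cfFullCount A X x ≤ K * (1 + X ^ (2 * cfDimension A)) := by
  obtain ⟨X₀, hX₀, c, -, C, hC, hb⟩ := cfDynCount_asymp_bounds hA h2
  refine ⟨C * (1 + X₀ ^ (2 * cfDimension A)), by positivity, fun x hx X hX0 => ?_⟩
  have hδ := (cfDimension_pos hA h2).le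
  have key : ∀ Y : ℝ, X₀ ≤ Y → cfFullCount A Y x ≤ C * Y ^ (2 * cfDimension A) := by
    intro Y hY
    obtain ⟨N, hN⟩ := exists_pow_two_gt Y
    rw [cfFullCount_eq_cfDynCount hA hx hN]
    exact (hb Y hY x hx N hN).2
  have h1 : 0 ≤ X ^ (2 * cfDimension A) := Real.rpow_nonneg hX0 _
  have h2' : 0 ≤ X₀ ^ (2 * cfDimension A) := Real.rpow_nonneg hX₀.le _
  have e : C * (1 + X₀ ^ (2 * cfDimension A)) * (1 + X ^ (2 * cfDimension A)) =
      C * X ^ (2 * cfDimension A) + C * X₀ ^ (2 * cfDimension A) +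
        (C + C * X₀ ^ (2 * cfDimension A) * X ^ (2 * cfDimension A)) := by ring
  have hrest : 0 ≤ C + C * X₀ ^ (2 * cfDimension A) * X ^ (2 * cfDimension A) := by positivity
  rw [e]
  rcases le_or_gt X₀ X with hle | hlt
  · have := key X hle
    nlinarith [mul_nonneg hC.le h2']
  · have := (cfFullCount_mono hA hx hlt.le).trans (key X₀ le_rfl)
    have : cfFullCount A X x ≤ C * X₀ ^ (2 * cfDimension A) := this
    nlinarith [mul_nonneg hC.le h1]

/-! ### The Laplace transform of the length counts -/

section Laplace

variable (A) (hA : ∀ a ∈ A, 1 ≤ a) (h2 : 2 ≤ A.card)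
include hA h2

/-- The indicator `1{denom ≤ e^{u/(2δ)}}` is `1{2δ log denom ≤ u}`. [folklore] -/
theorem cfDenom_le_exp_iff {d : ℝ} (hd : 0 < d) (u : ℝ) :
    d ≤ Real.exp (u / (2 * cfDimension A)) ↔ 2 * cfDimension A * Real.log d ≤ u := by
  have hδ := cfDimension_pos hA h2
  rw [← Real.log_le_iff_le_exp hd, le_div_iff₀ (by positivity)]
  constructor <;> intro h <;> nlinarith

omit hA h2 in
/-- `∫_{u > 0} 1{t ≤ u} e^{-su} du = e^{-st}/s` for `t ≥ 0`, `Re s > 0`. [folklore] -/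
theorem integral_indicator_exp {t : ℝ} (ht : 0 ≤ t) {s : ℂ} (hs : 0 < s.re) :
    ∫ u in Set.Ioi (0 : ℝ), (Set.Ici t).indicator (fun u : ℝ => Complex.exp (-s * u)) u = Complex.exp (-s * t) / s := by
  have hs' : (-s).re < 0 := by simpa using hs
  rw [integral_indicator measurableSet_Ici, Measure.restrict_restrict measurableSet_Ici]
  have hset : ∫ u in Set.Ici t ∩ Set.Ioi 0, Complex.exp (-s * u) = ∫ u in Set.Ioi t, Complex.exp (-s * u) := by
    rcases ht.lt_or_eq with hpos | hzero
    · rw [show Set.Ici t ∩ Set.Ioi (0 : ℝ) = Set.Ici t from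
        Set.ext fun u => ⟨fun h => h.1, fun h => ⟨h, lt_of_lt_of_le hpos h⟩⟩]
      exact integral_Ici_eq_integral_Ioi
    · rw [← hzero, show Set.Ici (0 : ℝ) ∩ Set.Ioi 0 = Set.Ioi 0 from
        Set.ext fun u => ⟨fun h => h.2, fun h => ⟨Set.mem_Ici.2 (le_of_lt (Set.mem_Ioi.1 h)), h⟩⟩]
  rw [hset, integral_exp_mul_complex_Ioi hs' t, neg_div_neg_eq]

omit hA h2 in
/-- Integrability of the indicator integrand. [folklore] -/
theorem integrableOn_indicator_exp (t : ℝ) {s : ℂ} (hs : 0 < s.re) :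
    IntegrableOn (fun u : ℝ => (Set.Ici t).indicator (fun u : ℝ => Complex.exp (-s * u)) u) (Set.Ioi 0) := by
  have hs' : (-s).re < 0 := by simpa using hs
  exact (integrableOn_exp_mul_complex_Ioi hs' 0).indicator measurableSet_Ici

/-- The weighted word indicator as a set indicator in `u`. [folklore] -/
theorem cfWordIndicatorW_eq {n : ℕ} (w : Fin n → A) {x : ℝ} (hx : x ∈ Icc (0 : ℝ) 1) (g : ℝ) (s : ℂ) (u : ℝ) :
    ((g * (if cfDenom (cfMat fun i => (w i : ℕ)) x ≤ Real.exp (u / (2 * cfDimension A)) then (1 : ℝ) else 0) : ℝ) : ℂ) *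
        Complex.exp (-s * u) =
      (g : ℂ) * (Set.Ici (2 * cfDimension A * Real.log (cfDenom (cfMat fun i => (w i : ℕ)) x))).indicator
        (fun u : ℝ => Complex.exp (-s * u)) u := by
  have hd := cfDenom_cfMat_pos (one_le_coe_digit hA w) hx
  by_cases h : 2 * cfDimension A * Real.log (cfDenom (cfMat fun i => (w i : ℕ)) x) ≤ u
  · have h1 : cfDenom (cfMat fun i => (w i : ℕ)) x ≤ Real.exp (u / (2 * cfDimension A)) :=
      (cfDenom_le_exp_iff A hA h2 hd u).2 h
    simp [Set.indicator, Set.mem_Ici, h, h1]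
  · have h1 : ¬cfDenom (cfMat fun i => (w i : ℕ)) x ≤ Real.exp (u / (2 * cfDimension A)) := fun h' =>
      h ((cfDenom_le_exp_iff A hA h2 hd u).1 h')
    simp [Set.indicator, Set.mem_Ici, h, h1]

omit hA h2 in
/-- `e^{-s · 2δ log d} = d^{-2δs} = wt_{δs}(M_w, x)`. [folklore] -/
theorem cexp_neg_mul_log_eq_cfWt (s : ℂ) (M : Matrix (Fin 2) (Fin 2) ℤ) (x : ℝ) :
    Complex.exp (-s * ((2 * cfDimension A * Real.log (cfDenom M x) : ℝ) : ℂ)) =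
      cfWt ((cfDimension A : ℂ) * s) M x := by
  rw [cfWt]
  congr 1
  push_cast
  ring

/-- The weighted integrand as a finite sum of indicators. [folklore] -/
theorem cfLenCountW_mul_cexp_eq (G : CfLip) (n : ℕ) (x : Icc (0 : ℝ) 1) (s : ℂ) (u : ℝ) :
    (cfLenCountW A G n (Real.exp (u / (2 * cfDimension A))) x : ℂ) * Complex.exp (-s * u) =
      ∑ w : Fin n → A, ((G.extend (cfMoeb (cfMat fun i => (w i : ℕ)) x)).re : ℂ) *
        (Set.Ici (2 * cfDimension A * Real.log (cfDenom (cfMat fun i => (w i : ℕ)) x))).indicator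
          (fun u : ℝ => Complex.exp (-s * u)) u := by
  rw [cfLenCountW, Complex.ofReal_sum, Finset.sum_mul]
  exact Finset.sum_congr rfl fun w _ => cfWordIndicatorW_eq A hA h2 w x.2 _ s u

/-- **Laplace transform of the weighted length count:** for `Re s > 0` and `G` real on `[0,1]`,
`∫_0^∞ N_n(e^{u/(2δ)}, x; G) e^{-su} du = s^{-1} (L_{δs}ⁿ G)(x)`. [cite: MageeOhWinter2019, §3.1 eq. (3.5)] -/
theorem integral_cfLenCountW {G : CfLip} (hGre : ∀ y : Icc (0 : ℝ) 1, (((G y).re : ℝ) : ℂ) = G y) (n : ℕ)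
    (x : Icc (0 : ℝ) 1) {s : ℂ} (hs : 0 < s.re) :
    ∫ u in Set.Ioi (0 : ℝ), (cfLenCountW A G n (Real.exp (u / (2 * cfDimension A))) x : ℂ) * Complex.exp (-s * u) =
      ((cfLOp A hA ((cfDimension A : ℂ) * s) ^ n) G x) / s := by
  simp_rw [cfLenCountW_mul_cexp_eq A hA h2 G n x s]
  rw [integral_finsetSum _ fun w _ => (integrableOn_indicator_exp _ hs).const_mul _, cfLOp_pow_apply_eq_sum,
    Finset.sum_div]
  refine Finset.sum_congr rfl fun w _ => ?_
  have hd := cfDenom_cfMat_pos (one_le_coe_digit hA w) x.2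
  have hq1 : (1 : ℝ) ≤ cfDenom (cfMat fun i => (w i : ℕ)) x :=
    (by exact_mod_cast one_le_cfQ (one_le_coe_digit hA w) :
      (1 : ℝ) ≤ (cfQ fun i => (w i : ℕ) : ℝ)).trans (cfDenom_cfMat_mem (one_le_coe_digit hA w) x.2).1
  have ht : 0 ≤ 2 * cfDimension A * Real.log (cfDenom (cfMat fun i => (w i : ℕ)) x) :=
    mul_nonneg (by linarith [cfDimension_pos hA h2]) (Real.log_nonneg hq1)
  rw [integral_const_mul, integral_indicator_exp ht hs, cexp_neg_mul_log_eq_cfWt,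
    CfLip.extend_of_mem _ (cfMoeb_cfMat_mem (one_le_coe_digit hA w) x.2), hGre]
  ring

/-- The integrand of `integral_cfLenCountW` is integrable. [folklore] -/
theorem integrable_cfLenCountW (G : CfLip) (n : ℕ) (x : Icc (0 : ℝ) 1) {s : ℂ} (hs : 0 < s.re) :
    IntegrableOn (fun u : ℝ => (cfLenCountW A G n (Real.exp (u / (2 * cfDimension A))) x : ℂ) * Complex.exp (-s * u))
      (Set.Ioi 0) := by
  have hterm : (fun u : ℝ => (cfLenCountW A G n (Real.exp (u / (2 * cfDimension A))) x : ℂ) * Complex.exp (-s * u)) =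
      fun u => ∑ w : Fin n → A, ((G.extend (cfMoeb (cfMat fun i => (w i : ℕ)) x)).re : ℂ) *
        (Set.Ici (2 * cfDimension A * Real.log (cfDenom (cfMat fun i => (w i : ℕ)) x))).indicator
          (fun u : ℝ => Complex.exp (-s * u)) u :=
    funext fun u => cfLenCountW_mul_cexp_eq A hA h2 G n x s u
  rw [hterm]
  exact integrable_finsetSum _ fun w _ => (integrableOn_indicator_exp _ hs).const_mul _

omit hA h2 in
/-- The norm of the weighted integrand (for `G ≥ 0`): `‖N_n(·; G) e^{-su}‖ = N_n(·; G) e^{-σu}`. [folklore] -/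
theorem norm_cfLenCountW_mul_cexp {G : CfLip} (hG0 : ∀ y : Icc (0 : ℝ) 1, 0 ≤ (G y).re) (n : ℕ) (X : ℝ) (x : ℝ)
    (s : ℂ) (u : ℝ) :
    ‖(cfLenCountW A G n X x : ℂ) * Complex.exp (-s * u)‖ = cfLenCountW A G n X x * Real.exp (-s.re * u) := by
  have hre : (-s * (u : ℂ)).re = -s.re * u := by
    simp [Complex.mul_re]
  rw [norm_mul, Complex.norm_real, Real.norm_of_nonneg (cfLenCountW_nonneg hG0 n X x), Complex.norm_exp, hre]

omit hA h2 in
/-- The norm of the plain integrand: `‖N_n e^{-su}‖ = N_n e^{-σu}`. [folklore] -/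
theorem norm_cfLenCount_mul_cexp (n : ℕ) (X : ℝ) (x : ℝ) (s : ℂ) (u : ℝ) :
    ‖(cfLenCount A n X x : ℂ) * Complex.exp (-s * u)‖ = cfLenCount A n X x * Real.exp (-s.re * u) := by
  have hre : (-s * (u : ℂ)).re = -s.re * u := by
    simp [Complex.mul_re]
  rw [norm_mul, Complex.norm_real, Real.norm_of_nonneg (cfLenCount_nonneg n X x), Complex.norm_exp, hre]

omit hA h2 in
/-- `𝟙` is real and non-negative. [folklore] -/
theorem const_one_real_nonneg :
    (∀ y : Icc (0 : ℝ) 1, ((((CfLip.const 1) y).re : ℝ) : ℂ) = (CfLip.const 1) y) ∧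
      ∀ y : Icc (0 : ℝ) 1, 0 ≤ ((CfLip.const 1) y).re := by
  constructor <;> intro y <;> simp

/-- The `L¹` norms of the plain terms: `∫_0^∞ N_n e^{-σu} du ≤ σ^{-1} 4^{δσ} λ_{δσ}ⁿ`. [folklore] -/
theorem integral_norm_cfLenCount_le (n : ℕ) (x : Icc (0 : ℝ) 1) {s : ℂ} (hs : 0 < s.re) :
    ∫ u in Set.Ioi (0 : ℝ), ‖(cfLenCount A n (Real.exp (u / (2 * cfDimension A))) x : ℂ) * Complex.exp (-s * u)‖ ≤
      (4 : ℝ) ^ (cfDimension A * s.re) * cfEig A (cfDimension A * s.re) ^ n / s.re := by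
  have hσ : 0 < ((s.re : ℂ)).re := by simpa using hs
  have hne := nonempty_of_two_le_card h2
  have hδ := cfDimension_pos hA h2
  simp_rw [norm_cfLenCount_mul_cexp]
  -- the real integral is the complex one at `σ`
  have hC := integral_cfLenCountW A hA h2 const_one_real_nonneg.1 n x hσ
  simp_rw [cfLenCountW_const_one] at hC
  have hreal : ∫ u in Set.Ioi (0 : ℝ), cfLenCount A n (Real.exp (u / (2 * cfDimension A))) x * Real.exp (-s.re * u) =
      (∑ w : Fin n → A, ((cfDenom (cfMat fun i => (w i : ℕ)) x) ^ 2) ^ (-(cfDimension A * s.re))) / s.re := by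
    have h1 : ((∫ u in Set.Ioi (0 : ℝ), cfLenCount A n (Real.exp (u / (2 * cfDimension A))) x * Real.exp (-s.re * u) : ℝ) : ℂ) =
        ∫ u in Set.Ioi (0 : ℝ), (cfLenCount A n (Real.exp (u / (2 * cfDimension A))) x : ℂ) * Complex.exp (-(s.re : ℂ) * u) := by
      rw [← integral_complex_ofReal]
      refine integral_congr_ae (Eventually.of_forall fun u => ?_)
      simp only [Complex.ofReal_mul, Complex.ofReal_exp, Complex.ofReal_neg]
    apply Complex.ofReal_injective
    rw [h1, hC, cfLOp_pow_const_one]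
    push_cast
    rw [Finset.sum_div, Finset.sum_div]
    refine Finset.sum_congr rfl fun w _ => ?_
    have hd := cfDenom_cfMat_pos (one_le_coe_digit hA w) x.2
    rw [show (cfDimension A : ℂ) * (s.re : ℂ) = ((cfDimension A * s.re : ℝ) : ℂ) by push_cast; ring,
      cfWt_ofReal _ _ hd]
  rw [hreal]
  refine div_le_div_of_nonneg_right ?_ hs.le
  have h := cfTransferSum_one_le' A hA hne (mul_nonneg hδ.le hs.le) n x.2
  rw [cfTransferSum] at h
  simpa only [mul_one] using h

/-- The `L¹` norms of the weighted terms (`G ≥ 0`):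
`∫_0^∞ N_n(·; G) e^{-σu} du ≤ ‖G‖ σ^{-1} 4^{δσ} λ_{δσ}ⁿ`. [folklore] -/
theorem integral_norm_cfLenCountW_le {G : CfLip} (hG0 : ∀ y : Icc (0 : ℝ) 1, 0 ≤ (G y).re) (n : ℕ)
    (x : Icc (0 : ℝ) 1) {s : ℂ} (hs : 0 < s.re) :
    ∫ u in Set.Ioi (0 : ℝ), ‖(cfLenCountW A G n (Real.exp (u / (2 * cfDimension A))) x : ℂ) * Complex.exp (-s * u)‖ ≤
      ‖G‖ * ((4 : ℝ) ^ (cfDimension A * s.re) * cfEig A (cfDimension A * s.re) ^ n / s.re) := by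
  have hσ : 0 < ((s.re : ℂ)).re := by simpa using hs
  have hi1 : Integrable (fun u : ℝ => ‖(cfLenCountW A G n (Real.exp (u / (2 * cfDimension A))) x : ℂ) *
      Complex.exp (-s * u)‖) (volume.restrict (Set.Ioi 0)) := (integrable_cfLenCountW A hA h2 G n x hs).norm
  have hi2 : Integrable (fun u : ℝ => ‖G‖ * ‖(cfLenCount A n (Real.exp (u / (2 * cfDimension A))) x : ℂ) *
      Complex.exp (-s * u)‖) (volume.restrict (Set.Ioi 0)) := by
    have h := (integrable_cfLenCountW A hA h2 (CfLip.const 1) n x hs).norm.const_mul ‖G‖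
    simp_rw [cfLenCountW_const_one] at h
    exact h
  calc ∫ u in Set.Ioi (0 : ℝ), ‖(cfLenCountW A G n (Real.exp (u / (2 * cfDimension A))) x : ℂ) * Complex.exp (-s * u)‖
      ≤ ∫ u in Set.Ioi (0 : ℝ), ‖G‖ * ‖(cfLenCount A n (Real.exp (u / (2 * cfDimension A))) x : ℂ) * Complex.exp (-s * u)‖ := by
        refine integral_mono hi1 hi2 fun u => ?_
        show _ ≤ _
        rw [norm_cfLenCountW_mul_cexp A hG0, norm_cfLenCount_mul_cexp, ← mul_assoc]
        exact mul_le_mul_of_nonneg_right (cfLenCountW_le G n _ x) (Real.exp_pos _).le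
    _ = ‖G‖ * ∫ u in Set.Ioi (0 : ℝ), ‖(cfLenCount A n (Real.exp (u / (2 * cfDimension A))) x : ℂ) * Complex.exp (-s * u)‖ :=
        integral_const_mul _ _
    _ ≤ _ := mul_le_mul_of_nonneg_left (integral_norm_cfLenCount_le A hA h2 n x hs) (norm_nonneg G)

/-! ### The Laplace transform of the full weighted count -/

/-- `λ_{δσ} < 1` for `σ > 1`. [folklore] -/
theorem cfEig_delta_mul_lt_one {σ : ℝ} (hσ : 1 < σ) : cfEig A (cfDimension A * σ) < 1 :=
  cfEig_lt_one_of_lt A hA h2 (by nlinarith [cfDimension_pos hA h2])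

/-- **The Laplace transform of `N(·; G)`:** for `Re s > 1` and `G ≥ 0` real,
`∫_0^∞ N(e^{u/(2δ)}, x; G) e^{-su} du = s^{-1} F_{G,x}(δ s) = s^{-1} ((1 - L_{δs})^{-1} G)(x)`.
[cite: MageeOhWinter2019, §3.1 eq. (3.5)–(3.7)] -/
theorem cfLaplace_eq {G : CfLip} (hGre : ∀ y : Icc (0 : ℝ) 1, (((G y).re : ℝ) : ℂ) = G y)
    (hG0 : ∀ y : Icc (0 : ℝ) 1, 0 ≤ (G y).re) (x : Icc (0 : ℝ) 1) {s : ℂ} (hs : 1 < s.re) :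
    ∫ u in Set.Ioi (0 : ℝ), (cfFullCountW A G (Real.exp (u / (2 * cfDimension A))) x : ℂ) * Complex.exp (-s * u) =
      cfResFun A hA G x ((cfDimension A : ℂ) * s) / s := by
  have hs0 : 0 < s.re := by linarith
  have hδ := cfDimension_pos hA h2
  set f : ℕ → ℝ → ℂ := fun n u =>
    (cfLenCountW A G n (Real.exp (u / (2 * cfDimension A))) x : ℂ) * Complex.exp (-s * u) with hf
  have hpt : ∀ u : ℝ, (cfFullCountW A G (Real.exp (u / (2 * cfDimension A))) x : ℂ) * Complex.exp (-s * u) =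
      ∑' n, f n u := by
    intro u
    rw [cfFullCountW, Complex.ofReal_tsum, ← tsum_mul_right]
  simp_rw [hpt]
  have hint : ∀ n, Integrable (f n) (volume.restrict (Set.Ioi 0)) := fun n =>
    integrable_cfLenCountW A hA h2 G n x hs0
  have hsum : Summable fun n => ∫ u, ‖f n u‖ ∂(volume.restrict (Set.Ioi 0)) := by
    have hl0 := (cfEig_pos (A := A) (cfDimension A * s.re)).le
    have hlt := cfEig_delta_mul_lt_one A hA h2 hs
    refine Summable.of_nonneg_of_le (fun n => integral_nonneg fun u => norm_nonneg _)
      (fun n => integral_norm_cfLenCountW_le A hA h2 hG0 n x hs0) ?_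
    simp_rw [div_eq_mul_inv]
    exact (((summable_geometric_of_lt_one hl0 hlt).mul_left _).mul_right _).mul_left _
  rw [← integral_tsum_of_summable_integral_norm hint hsum]
  have hterm : ∀ n, ∫ u, f n u ∂(volume.restrict (Set.Ioi 0)) =
      ((cfLOp A hA ((cfDimension A : ℂ) * s) ^ n) G x) / s := fun n =>
    integral_cfLenCountW A hA h2 hGre n x hs0
  simp_rw [hterm]
  have hlt : cfDimension A < ((cfDimension A : ℂ) * s).re := by
    rw [Complex.re_ofReal_mul]
    nlinarith
  rw [tsum_div_const, cfResFun_eq_tsum A hA h2 G x hlt]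

/-! ### The Tauberian data -/

/-- The weighted count in the logarithmic variable: `a(u) = N(e^{u/(2δ)}, x; G)`. [folklore] -/
def cfA (G : CfLip) (x : ℝ) (u : ℝ) : ℝ := cfFullCountW A G (Real.exp (u / (2 * cfDimension A))) x

/-- The normalized density `B(u) = 1{u > 0} e^{-u} a(u)`. [folklore] -/
def cfB (G : CfLip) (x : ℝ) (u : ℝ) : ℝ := (Set.Ioi (0 : ℝ)).indicator (fun u => Real.exp (-u) * cfA A G x u) u

/-- `a` is non-decreasing (`G ≥ 0`). [folklore] -/
theorem cfA_mono {G : CfLip} (hG0 : ∀ y : Icc (0 : ℝ) 1, 0 ≤ (G y).re) {x : ℝ} (hx : x ∈ Set.Icc (0 : ℝ) 1) :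
    Monotone (cfA A G x) := by
  intro u v huv
  have hδ := cfDimension_pos hA h2
  exact cfFullCountW_mono hA hG0 hx (Real.exp_le_exp.2 (div_le_div_of_nonneg_right huv (by positivity)))

omit hA h2 in
/-- `a ≥ 0` (`G ≥ 0`). [folklore] -/
theorem cfA_nonneg {G : CfLip} (hG0 : ∀ y : Icc (0 : ℝ) 1, 0 ≤ (G y).re) (x u : ℝ) : 0 ≤ cfA A G x u :=
  cfFullCountW_nonneg hG0 _ _

/-- `B` is measurable. [folklore] -/
theorem measurable_cfB {G : CfLip} (hG0 : ∀ y : Icc (0 : ℝ) 1, 0 ≤ (G y).re) {x : ℝ} (hx : x ∈ Set.Icc (0 : ℝ) 1) :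
    Measurable (cfB A G x) := by
  refine Measurable.indicator ?_ measurableSet_Ioi
  exact (Real.continuous_exp.comp continuous_neg).measurable.mul (cfA_mono A hA h2 hG0 hx).measurable

omit hA h2 in
/-- `B ≥ 0`. [folklore] -/
theorem cfB_nonneg {G : CfLip} (hG0 : ∀ y : Icc (0 : ℝ) 1, 0 ≤ (G y).re) (x u : ℝ) : 0 ≤ cfB A G x u := by
  unfold cfB
  by_cases hu : u ∈ Set.Ioi (0 : ℝ)
  · rw [Set.indicator_of_mem hu]
    exact mul_nonneg (Real.exp_pos _).le (cfA_nonneg A hG0 x u)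
  · rw [Set.indicator_of_notMem hu]

omit hA h2 in
/-- `B = 0` on `u ≤ 0`. [folklore] -/
theorem cfB_of_nonpos (G : CfLip) (x : ℝ) {u : ℝ} (hu : u ≤ 0) : cfB A G x u = 0 :=
  Set.indicator_of_notMem (fun h : u ∈ Set.Ioi (0 : ℝ) => not_lt.2 hu h) _

omit hA h2 in
/-- `B` on `u > 0`. [folklore] -/
theorem cfB_of_pos (G : CfLip) (x : ℝ) {u : ℝ} (hu : 0 < u) : cfB A G x u = Real.exp (-u) * cfA A G x u :=
  Set.indicator_of_mem (show u ∈ Set.Ioi (0 : ℝ) from hu) _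

/-- `B` is slowly decreasing: `B(u) e^{u-v} ≤ B(v)` for `u ≤ v`. [folklore] -/
theorem cfB_mono {G : CfLip} (hG0 : ∀ y : Icc (0 : ℝ) 1, 0 ≤ (G y).re) {x : ℝ} (hx : x ∈ Set.Icc (0 : ℝ) 1)
    (u v : ℝ) (huv : u ≤ v) : cfB A G x u * Real.exp (u - v) ≤ cfB A G x v := by
  rcases le_or_gt u 0 with hu | hu
  · rw [cfB_of_nonpos A G x hu, zero_mul]; exact cfB_nonneg A hG0 x v
  · have hv : 0 < v := lt_of_lt_of_le hu huv
    rw [cfB_of_pos A G x hu, cfB_of_pos A G x hv]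
    have hmono := cfA_mono A hA h2 hG0 hx huv
    have hexp : Real.exp (-u) * Real.exp (u - v) = Real.exp (-v) := by
      rw [← Real.exp_add]
      congr 1
      ring
    have e : Real.exp (-u) * cfA A G x u * Real.exp (u - v) = Real.exp (-v) * cfA A G x u := by
      rw [← hexp]
      ring
    rw [e]
    exact mul_le_mul_of_nonneg_left hmono (Real.exp_pos _).le

/-- **`B` is bounded** (the a priori bound `N(X, x) = O(X^{2δ})`). [cite: MageeOhWinter2019, Thm. 11] -/
theorem cfB_le (G : CfLip) : ∃ K₀ : ℝ, 0 < K₀ ∧ ∀ x ∈ Set.Icc (0 : ℝ) 1, ∀ u : ℝ, cfB A G x u ≤ K₀ := by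
  obtain ⟨K, hK, hb⟩ := cfFullCount_le hA h2
  refine ⟨2 * K * ‖G‖ + 1, by positivity, fun x hx u => ?_⟩
  rcases le_or_gt u 0 with hu | hu
  · rw [cfB_of_nonpos A G x hu]; positivity
  · rw [cfB_of_pos A G x hu, cfA]
    have hδ := cfDimension_pos hA h2
    have hX0 : 0 ≤ Real.exp (u / (2 * cfDimension A)) := (Real.exp_pos _).le
    have h := hb x hx _ hX0
    have hpow : Real.exp (u / (2 * cfDimension A)) ^ (2 * cfDimension A) = Real.exp u := by
      rw [← Real.exp_mul, div_mul_cancel₀ _ (by positivity)]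
    rw [hpow] at h
    have hW := cfFullCountW_le_norm_mul hA G hx (Real.exp (u / (2 * cfDimension A)))
    have he : Real.exp (-u) * Real.exp u = 1 := by rw [← Real.exp_add]; simp
    have he1 : Real.exp (-u) ≤ 1 := Real.exp_le_one_iff.2 (by linarith)
    have hG := norm_nonneg G
    have hF := cfFullCount_nonneg (A := A) (Real.exp (u / (2 * cfDimension A))) x
    calc Real.exp (-u) * cfFullCountW A G (Real.exp (u / (2 * cfDimension A))) x
        ≤ Real.exp (-u) * (‖G‖ * (K * (1 + Real.exp u))) := by
          refine mul_le_mul_of_nonneg_left (hW.trans ?_) (Real.exp_pos _).le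
          exact mul_le_mul_of_nonneg_left h hG
      _ = ‖G‖ * K * Real.exp (-u) + ‖G‖ * K * (Real.exp (-u) * Real.exp u) := by ring
      _ ≤ ‖G‖ * K * 1 + ‖G‖ * K * 1 := by
          rw [he]
          nlinarith [mul_nonneg hG hK.le]
      _ ≤ 2 * K * ‖G‖ + 1 := by nlinarith [mul_nonneg hG hK.le]

/-- `B e^{-εu}` is integrable on `(0, ∞)` for `ε > 0`. [folklore] -/
theorem integrableOn_cfB {G : CfLip} (hG0 : ∀ y : Icc (0 : ℝ) 1, 0 ≤ (G y).re) {x : ℝ} (hx : x ∈ Set.Icc (0 : ℝ) 1)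
    {ε : ℝ} (hε : 0 < ε) : IntegrableOn (fun u => cfB A G x u * Real.exp (-(ε * u))) (Set.Ioi 0) := by
  obtain ⟨K₀, hK₀, hb⟩ := cfB_le A hA h2 G
  have hg : IntegrableOn (fun u : ℝ => K₀ * Real.exp (-ε * u)) (Set.Ioi 0) :=
    (exp_neg_integrableOn_Ioi 0 hε).const_mul K₀
  refine Integrable.mono' hg ?_ (Eventually.of_forall fun u => ?_)
  · exact ((measurable_cfB A hA h2 hG0 hx).mul
      (Real.continuous_exp.comp (continuous_const.mul continuous_id).neg).measurable).aestronglyMeasurable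
  · rw [Real.norm_eq_abs, abs_of_nonneg (mul_nonneg (cfB_nonneg A hG0 x u) (Real.exp_pos _).le), neg_mul]
    exact mul_le_mul_of_nonneg_right (hb x hx u) (Real.exp_pos _).le

omit hA h2 in
/-- On `u > 0`: `B(u) e^{-(s-1)u} = a(u) e^{-su}` (as complex numbers). [folklore] -/
theorem cfB_mul_cexp (G : CfLip) (x : ℝ) {u : ℝ} (hu : 0 < u) (s : ℂ) :
    ((cfB A G x u : ℝ) : ℂ) * Complex.exp (-(s - 1) * u) = (cfA A G x u : ℂ) * Complex.exp (-s * u) := by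
  rw [cfB_of_pos A G x hu, Complex.ofReal_mul, Complex.ofReal_exp, mul_comm (Complex.exp _) (cfA A G x u : ℂ),
    mul_assoc, ← Complex.exp_add]
  congr 2
  push_cast
  ring

/-- Integrability of the complex Laplace integrand of `B`. [folklore] -/
theorem integrableOn_cfB_cexp {G : CfLip} (hG0 : ∀ y : Icc (0 : ℝ) 1, 0 ≤ (G y).re) {x : ℝ}
    (hx : x ∈ Set.Icc (0 : ℝ) 1) {s : ℂ} (hs : 1 < s.re) :
    IntegrableOn (fun u : ℝ => ((cfB A G x u : ℝ) : ℂ) * Complex.exp (-(s - 1) * u)) (Set.Ioi 0) := by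
  have hg := integrableOn_cfB A hA h2 hG0 hx (by linarith : 0 < s.re - 1)
  refine Integrable.mono' hg ?_ (Eventually.of_forall fun u => ?_)
  · exact ((Complex.continuous_ofReal.measurable.comp (measurable_cfB A hA h2 hG0 hx)).mul
      (Complex.continuous_exp.comp (continuous_const.mul
        (Complex.continuous_ofReal.comp continuous_id))).measurable).aestronglyMeasurable
  · have hre : (-(s - 1) * (u : ℂ)).re = -((s.re - 1) * u) := by
      simp only [neg_mul, Complex.neg_re, Complex.mul_re, Complex.sub_re, Complex.one_re, Complex.ofReal_re,
        Complex.sub_im, Complex.one_im, Complex.ofReal_im, mul_zero, sub_zero]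
    rw [norm_mul, Complex.norm_real, Real.norm_of_nonneg (cfB_nonneg A hG0 x u), Complex.norm_exp, hre]

omit hA h2 in
/-- `∫_0^∞ c e^{-(s-1)u} du = c/(s-1)` for `Re s > 1`. [folklore] -/
theorem integral_const_mul_cexp (c : ℝ) {s : ℂ} (hs : 1 < s.re) :
    ∫ u in Set.Ioi (0 : ℝ), (c : ℂ) * Complex.exp (-(s - 1) * u) = c / (s - 1) := by
  have hsm1 : (-(s - 1)).re < 0 := by simp; linarith
  rw [integral_const_mul, integral_exp_mul_complex_Ioi hsm1 0, Complex.ofReal_zero, mul_zero, Complex.exp_zero,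
    neg_div_neg_eq, ← div_eq_mul_one_div]

/-- **The renewal constant** `c_G(x) = ν(G) h(x) / (δ_A κ)`, `κ = ∫ 2 h log(1/·) dν`.
[cite: MageeOhWinter2019, Prop. 17] -/
def cfRenewalConstW (G : CfLip) (x : Set.Icc (0 : ℝ) 1) : ℝ :=
  cfInt (cfNuδ A hA h2) (fun y => (G.extend y).re) * cfHδ A hA h2 x /
    (cfDimension A * cfInt (cfNuδ A hA h2) (cfG A hA h2))

/-- **The renewal constant for `G ≡ 1`:** `c(x) = h(x) / (δ_A κ)`. [cite: MageeOhWinter2019, Prop. 17] -/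
def cfRenewalConst (x : Set.Icc (0 : ℝ) 1) : ℝ :=
  cfHδ A hA h2 x / (cfDimension A * cfInt (cfNuδ A hA h2) (cfG A hA h2))

/-- `c_𝟙(x) = c(x)`. [folklore] -/
theorem cfRenewalConstW_const_one (x : Set.Icc (0 : ℝ) 1) :
    cfRenewalConstW A hA h2 (CfLip.const 1) x = cfRenewalConst A hA h2 x := by
  rw [cfRenewalConstW, cfRenewalConst]
  have : cfInt (cfNuδ A hA h2) (fun y => ((CfLip.const 1).extend y).re) = 1 := by
    rw [cfInt]
    simp [show ∀ y : ℝ, (CfLip.const (1 : ℂ)).extend y = 1 from fun _ => rfl]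
  rw [this, one_mul]

/-- `c(x) > 0`. [cite: MageeOhWinter2019, Prop. 17] -/
theorem cfRenewalConst_pos' (x : Set.Icc (0 : ℝ) 1) : 0 < cfRenewalConst A hA h2 x :=
  cfRenewalConst_pos A hA h2 x

/-- `ν(G) = ∫ Re G dν` for `G` real on `[0,1]`. [folklore] -/
theorem cfNuL_eq_cfInt_re {G : CfLip} (hGre : ∀ y : Icc (0 : ℝ) 1, (((G y).re : ℝ) : ℂ) = G y) :
    cfNuL A hA h2 G = ((cfInt (cfNuδ A hA h2) (fun y => (G.extend y).re) : ℝ) : ℂ) :=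
  cfNuL_of_real A hA h2 (g := fun y => (G.extend y).re) fun y => by rw [CfLip.extend_coe, hGre]

/-- **The Tauberian conclusion:** `B(u) → c_G(x)` (Wiener–Ikehara in Laplace form applied to the
continued Laplace transform `s^{-1} F_{G,x}(δ s) - c_G(x)/(s-1)`). [cite: MageeOhWinter2019, Prop. 17] -/
theorem tendsto_cfB {G : CfLip} (hGre : ∀ y : Icc (0 : ℝ) 1, (((G y).re : ℝ) : ℂ) = G y)
    (hG0 : ∀ y : Icc (0 : ℝ) 1, 0 ≤ (G y).re) (x : Set.Icc (0 : ℝ) 1) :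
    Tendsto (cfB A G x) atTop (𝓝 (cfRenewalConstW A hA h2 G x)) := by
  have hδ := cfDimension_pos hA h2
  have hκ := cfInt_cfG_pos A hA h2
  have hδC : (cfDimension A : ℂ) ≠ 0 := Complex.ofReal_ne_zero.2 hδ.ne'
  have hκC : ((cfInt (cfNuδ A hA h2) (cfG A hA h2) : ℝ) : ℂ) ≠ 0 := Complex.ofReal_ne_zero.2 hκ.ne'
  set c : ℝ := cfRenewalConstW A hA h2 G x with hcdef
  have hc : (c : ℂ) = ((cfInt (cfNuδ A hA h2) (fun y => (G.extend y).re) : ℝ) : ℂ) * (cfHδ A hA h2 x : ℂ) /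
      ((cfDimension A : ℂ) * ((cfInt (cfNuδ A hA h2) (cfG A hA h2) : ℝ) : ℂ)) := by
    simp only [hcdef, cfRenewalConstW, Complex.ofReal_div, Complex.ofReal_mul]
  obtain ⟨ε, hε, w, hw, hpole⟩ := cfResFun_near_delta A hA h2 G x
  -- the continued Laplace transform
  set Gs : ℂ → ℂ := fun s => if s = 1 then w (cfDimension A : ℂ) - c
    else cfResFun A hA G x ((cfDimension A : ℂ) * s) / s - c / (s - 1) with hGs
  -- `Gs` is the Laplace transform of `B - c` on `Re s > 1`
  have hGeq : ∀ s : ℂ, 1 < s.re →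
      Gs s = ∫ u in Set.Ioi (0 : ℝ), ((cfB A G x u - c : ℝ) : ℂ) * Complex.exp (-(s - 1) * u) := by
    intro s hs
    have hs1 : s ≠ 1 := fun h => by rw [h, Complex.one_re] at hs; exact lt_irrefl _ hs
    simp only [hGs, if_neg hs1]
    have hI1 := integrableOn_cfB_cexp A hA h2 hG0 x.2 hs
    have hsm1 : (-(s - 1)).re < 0 := by simp; linarith
    have hI2 : IntegrableOn (fun u : ℝ => (c : ℂ) * Complex.exp (-(s - 1) * u)) (Set.Ioi 0) :=
      (integrableOn_exp_mul_complex_Ioi hsm1 0).const_mul _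
    have hsplit : ∀ u : ℝ, ((cfB A G x u - c : ℝ) : ℂ) * Complex.exp (-(s - 1) * u) =
        ((cfB A G x u : ℝ) : ℂ) * Complex.exp (-(s - 1) * u) - (c : ℂ) * Complex.exp (-(s - 1) * u) := by
      intro u; push_cast; ring
    simp_rw [hsplit]
    rw [integral_sub hI1 hI2, integral_const_mul_cexp c hs,
      setIntegral_congr_fun measurableSet_Ioi (fun u hu => cfB_mul_cexp A G x hu s)]
    show _ = (∫ u in Set.Ioi (0 : ℝ), (cfFullCountW A G (Real.exp (u / (2 * cfDimension A))) x : ℂ) *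
      Complex.exp (-s * u)) - c / (s - 1)
    rw [cfLaplace_eq A hA h2 hGre hG0 x hs]
  -- `Gs` is continuous on `Re s ≥ 1`
  have hGcont : ContinuousOn Gs {s : ℂ | 1 ≤ s.re} := by
    intro s₀ hs₀
    apply ContinuousAt.continuousWithinAt
    have hs₀re : 1 ≤ s₀.re := hs₀
    have hs₀0 : s₀ ≠ 0 := fun h => by rw [h, Complex.zero_re] at hs₀re; linarith
    by_cases h1 : s₀ = 1
    · subst h1
      have hr : 0 < min (ε / cfDimension A) 1 := lt_min (div_pos hε hδ) one_pos
      have heq : (fun s : ℂ => w ((cfDimension A : ℂ) * s) / s - c / s) =ᶠ[𝓝 (1 : ℂ)] Gs := by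
        filter_upwards [Metric.ball_mem_nhds (1 : ℂ) hr] with s hs
        rw [Metric.mem_ball, lt_min_iff] at hs
        have hs0 : s ≠ 0 := by
          intro h0; rw [h0, dist_zero_left, norm_one] at hs; exact lt_irrefl _ hs.2
        by_cases hs1 : s = 1
        · subst hs1
          simp only [hGs, if_pos rfl, mul_one, div_one]
        · simp only [hGs, if_neg hs1]
          have hball : (cfDimension A : ℂ) * s ∈ ball (cfDimension A : ℂ) ε := by
            rw [Metric.mem_ball, dist_eq_norm, show (cfDimension A : ℂ) * s - cfDimension A =
              (cfDimension A : ℂ) * (s - 1) by ring, norm_mul, Complex.norm_real, Real.norm_of_nonneg hδ.le]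
            rw [dist_eq_norm] at hs
            calc cfDimension A * ‖s - 1‖ < cfDimension A * (ε / cfDimension A) :=
                  mul_lt_mul_of_pos_left hs.1 hδ
              _ = ε := mul_div_cancel₀ _ hδ.ne'
          have hne : (cfDimension A : ℂ) * s ≠ (cfDimension A : ℂ) := by
            intro h
            apply hs1
            have : (cfDimension A : ℂ) * s = (cfDimension A : ℂ) * 1 := by rw [h, mul_one]
            exact mul_left_cancel₀ hδC this
          have hsub : (cfDimension A : ℂ) * s - cfDimension A ≠ 0 := sub_ne_zero.2 hne
          have hs1' : s - 1 ≠ 0 := sub_ne_zero.2 hs1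
          rw [hpole _ hball hne, cfNuL_eq_cfInt_re A hA h2 hGre, hc]
          field_simp
          ring
      have hcont : ContinuousAt (fun s : ℂ => w ((cfDimension A : ℂ) * s) / s - c / s) 1 := by
        have hw1 : ContinuousAt w ((cfDimension A : ℂ) * 1) := by rwa [mul_one]
        have hcomp : ContinuousAt (fun s : ℂ => w ((cfDimension A : ℂ) * s)) 1 :=
          hw1.comp (continuous_const.mul continuous_id).continuousAt
        exact (hcomp.div continuousAt_id one_ne_zero).sub (continuousAt_const.div continuousAt_id one_ne_zero)
      exact hcont.congr heq
    · have heq : (fun s : ℂ => cfResFun A hA G x ((cfDimension A : ℂ) * s) / s - c / (s - 1)) =ᶠ[𝓝 s₀] Gs := by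
        filter_upwards [eventually_ne_nhds h1] with s hs
        simp only [hGs, if_neg hs]
      have hre : cfDimension A ≤ ((cfDimension A : ℂ) * s₀).re := by
        rw [Complex.re_ofReal_mul]
        nlinarith
      have hne : (cfDimension A : ℂ) * s₀ ≠ (cfDimension A : ℂ) := by
        intro h
        apply h1
        have : (cfDimension A : ℂ) * s₀ = (cfDimension A : ℂ) * 1 := by rw [h, mul_one]
        exact mul_left_cancel₀ hδC this
      have hF : ContinuousAt (fun s : ℂ => cfResFun A hA G x ((cfDimension A : ℂ) * s)) s₀ :=
        (continuousAt_cfResFun A hA h2 G x hre hne).comp (continuous_const.mul continuous_id).continuousAt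
      have hcont : ContinuousAt (fun s : ℂ => cfResFun A hA G x ((cfDimension A : ℂ) * s) / s - c / (s - 1)) s₀ :=
        (hF.div continuousAt_id hs₀0).sub
          (continuousAt_const.div (continuousAt_id.sub continuousAt_const) (sub_ne_zero.2 h1))
      exact hcont.congr heq
  exact Literature.NumberTheory.LFunctions.WienerIkehara.tendsto_of_laplace c (measurable_cfB A hA h2 hG0 x.2)
    (cfB_nonneg A hG0 x) (fun u hu => cfB_of_nonpos A G x hu) (fun u v huv => cfB_mono A hA h2 hG0 x.2 u v huv)
    (fun ε' hε' => integrableOn_cfB A hA h2 hG0 x.2 hε') hGcont hGeq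

/-- **The renewal theorem for `Γ_A` with a test function** ([MageeOhWinter2019, Prop. 17] for
`q = 1`, main term; Lalley's theorem for the semigroup `Γ_A`): for every real non-negative Lipschitz
`G` on `[0,1]` and every `x ∈ [0,1]`,
`N(X, x; G) = Σ_{w ∈ A^*, denom(M_w, x) ≤ X} G(M_w x) ~ ν(G) c(x) X^{2δ_A}` as `X → ∞`, with
`c(x) = h(x) / (δ_A ∫ 2 h log(1/·) dν)`. [cite: MageeOhWinter2019, Prop. 17] -/
theorem cfFullCountW_asymp {G : CfLip} (hGre : ∀ y : Icc (0 : ℝ) 1, (((G y).re : ℝ) : ℂ) = G y)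
    (hG0 : ∀ y : Icc (0 : ℝ) 1, 0 ≤ (G y).re) (x : Set.Icc (0 : ℝ) 1) :
    Tendsto (fun X : ℝ => cfFullCountW A G X x / X ^ (2 * cfDimension A)) atTop
      (𝓝 (cfRenewalConstW A hA h2 G x)) := by
  have hδ := cfDimension_pos hA h2
  have hB := tendsto_cfB A hA h2 hGre hG0 x
  have hφ : Tendsto (fun X : ℝ => 2 * cfDimension A * Real.log X) atTop atTop :=
    Tendsto.const_mul_atTop (by positivity) Real.tendsto_log_atTop
  refine (hB.comp hφ).congr' ?_
  filter_upwards [eventually_gt_atTop 1] with X hX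
  have hX0 : 0 < X := by linarith
  have hu : 0 < 2 * cfDimension A * Real.log X := mul_pos (by positivity) (Real.log_pos hX)
  show cfB A G x (2 * cfDimension A * Real.log X) = cfFullCountW A G X x / X ^ (2 * cfDimension A)
  rw [cfB_of_pos A G x hu, cfA]
  have h1 : Real.exp (2 * cfDimension A * Real.log X / (2 * cfDimension A)) = X := by
    rw [mul_div_cancel_left₀ _ (by positivity : (2 * cfDimension A) ≠ 0), Real.exp_log hX0]
  have h2' : Real.exp (-(2 * cfDimension A * Real.log X)) = (X ^ (2 * cfDimension A))⁻¹ := by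
    rw [Real.rpow_def_of_pos hX0, ← Real.exp_neg]
    congr 1
    ring
  rw [h1, h2', inv_mul_eq_div]

/-- **The renewal theorem for `Γ_A`** ([MageeOhWinter2019, Prop. 17] with `G ≡ 1`): for every
`x ∈ [0,1]`, `N(X, x) = #{w ∈ A^* : denom(M_w, x) ≤ X} ~ c(x) X^{2δ_A}` as `X → ∞`, with
`c(x) = h(x) / (δ_A ∫ 2 h log(1/·) dν) > 0`; at `x = 0` this is the count of continuants `q(w) ≤ X`
with digits in `A` (Hensley). [cite: MageeOhWinter2019, Prop. 17] -/
theorem cfFullCount_asymp (x : Set.Icc (0 : ℝ) 1) :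
    Tendsto (fun X : ℝ => cfFullCount A X x / X ^ (2 * cfDimension A)) atTop (𝓝 (cfRenewalConst A hA h2 x)) := by
  have h := cfFullCountW_asymp A hA h2 const_one_real_nonneg.1 const_one_real_nonneg.2 x
  rw [cfRenewalConstW_const_one] at h
  simpa only [cfFullCountW_const_one] using h

/-- Equivalent form with the truncated count: for any cut-offs `N(X)` with `2^{N(X)} > X²`,
`N_{N(X)}(X, x) X^{-2δ} → c(x)`. [cite: MageeOhWinter2019, Prop. 17] -/
theorem cfDynCount_asymp (x : Set.Icc (0 : ℝ) 1) {Ncut : ℝ → ℕ} (hN : ∀ X, X ^ 2 < (2 : ℝ) ^ Ncut X) :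
    Tendsto (fun X : ℝ => cfDynCount A (Ncut X) X x / X ^ (2 * cfDimension A)) atTop
      (𝓝 (cfRenewalConst A hA h2 x)) := by
  refine (cfFullCount_asymp A hA h2 x).congr' (Eventually.of_forall fun X => ?_)
  rw [cfFullCount_eq_cfDynCount hA x.2 (hN X)]

end Laplace

end Literature.NumberTheory.Sieve
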